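import Summits.KontsevichZagierPeriods.KontsevichZagierPeriods.Theses.Grothendieck
import Literature.NumberTheory.Transcendental.KZCalculus

/-!
# Sketch (crux-ideate r1, ideator 2 / gen 2): first-lemma signatures for idea `octant-area-sphero-conal`

Crux `GpcLegendreLemniscatic` (stmt-KontsevichZagierPeriods-0280).  LEVER: Jacobi's sphero-conal
(confocal) parametrisation of the positive octant of the unit sphere by `C_k × C_{k′}`,
`Ψ(x,y) = (x√(1−k′²y²), √((1−x²)(1−y²)), y√(1−k²x²))`, pulls the area form of `S²` back to the
one-representation Legendre integrand `F_m = κ_m ⊗ e_{1−m} + e_m ⊗ κ_{1−m} − κ_m ⊗ κ_{1−m}`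
(`m = k²`), which is *verbatim* the integrand of route GaussManinCertificates' `LegendreSector`; hence ONE
rule-(2) move `[sq, F_m] ~ [quarter disc, (1 − X² − Z²)^{-1/2}]` (planar chart `(X,Z)` of the octant)
and Legendre's relation `EK′ + E′K − KK′ = π/2` for EVERY modulus reads: "the octant has area π/2".
At `m = ½` the crux is the swap-symmetrisation of `F_{1/2}` and all coefficients are rational.
Nothing is proved here; every `def … : Prop` below elaborates (the card's First lemma is `OctantTransfer`).
-/

noncomputable section

set_option linter.dupNamespace false

open MeasureTheory Set
open Literature.NumberTheory.Transcendental
open Literature.NumberTheory.Transcendental.KZ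

namespace Summit.KontsevichZagierPeriods.KontsevichZagierPeriods.Cruxes.GpcLegendreLemniscatic.SpheroConal

/-- The open unit square `(0,1)²` in the crux's typing. -/
def sq : Set (Fin 2 → ℝ) := {x | ∀ i, x i ∈ Ioo (0:ℝ) 1}

/-- The open quarter disc `Q = {X > 0, Z > 0, X² + Z² < 1}` (planar chart of the open octant). -/
def quarterDisc : Set (Fin 2 → ℝ) := {w | 0 < w 0 ∧ 0 < w 1 ∧ w 0 ^ 2 + w 1 ^ 2 < 1}

/-- The hemisphere density `1/√(1 − X² − Z²)` (area form of `S²` in the chart `(X,Z) ↦ (X, √(1−X²−Z²), Z)`). -/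
def hemisphereDensity (w : Fin 2 → ℝ) : ℝ := 1 / Real.sqrt (1 - w 0 ^ 2 - w 1 ^ 2)

/-- The one-representation Legendre integrand at parameter `m = k²`, written VERBATIM as the `F m x` of
`Theses.GaussManinCertificates.LegendreSector` / `LegendreModulusPropagation`:
`κ_m(x₀)·e_{1−m}(x₁) + e_m(x₀)·κ_{1−m}(x₁) − κ_m(x₀)·κ_{1−m}(x₁)`. -/
def legendreOneRep (m : ℝ) (x : Fin 2 → ℝ) : ℝ :=
  1 / Real.sqrt ((1 - x 0 ^ 2) * (1 - m * x 0 ^ 2)) * (Real.sqrt (1 - (1 - m) * x 1 ^ 2) / Real.sqrt (1 - x 1 ^ 2)) +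
    Real.sqrt (1 - m * x 0 ^ 2) / Real.sqrt (1 - x 0 ^ 2) * (1 / Real.sqrt ((1 - x 1 ^ 2) * (1 - (1 - m) * x 1 ^ 2))) -
    1 / Real.sqrt ((1 - x 0 ^ 2) * (1 - m * x 0 ^ 2)) * (1 / Real.sqrt ((1 - x 1 ^ 2) * (1 - (1 - m) * x 1 ^ 2)))

/-- The crux's integrand formula, verbatim (`2e(x₀)κ(x₁) − κ(x₀)κ(x₁)` at `m = ½`). -/
def cruxIntegrand (x : Fin 2 → ℝ) : ℝ :=
  2 * Real.sqrt (1 - x 0 ^ 2 / 2) / Real.sqrt (1 - x 0 ^ 2) / Real.sqrt ((1 - x 1 ^ 2) * (1 - x 1 ^ 2 / 2)) -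
    1 / Real.sqrt ((1 - x 0 ^ 2) * (1 - x 0 ^ 2 / 2)) / Real.sqrt ((1 - x 1 ^ 2) * (1 - x 1 ^ 2 / 2))

/-- **Jacobi's sphero-conal map, planar chart**: `Φ_m(x,y) = (X,Z) = (x·√(1 − (1−m)y²), y·√(1 − m x²))`.
The third coordinate of the point of `S²` is `Y = √((1−x²)(1−y²))`; `X² + Y² + Z² = 1` identically. -/
def spheroConal (m : ℝ) (x : Fin 2 → ℝ) : Fin 2 → ℝ :=
  ![x 0 * Real.sqrt (1 - (1 - m) * x 1 ^ 2), x 1 * Real.sqrt (1 - m * x 0 ^ 2)]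

/-- The Jacobian determinant of `Φ_m`: `det DΦ_m = (1 − m x² − (1−m) y²)/(√(1 − m x²)·√(1 − (1−m) y²)) > 0` on `sq`. -/
def spheroConalDet (m : ℝ) (x : Fin 2 → ℝ) : ℝ :=
  (1 - m * x 0 ^ 2 - (1 - m) * x 1 ^ 2) / (Real.sqrt (1 - m * x 0 ^ 2) * Real.sqrt (1 - (1 - m) * x 1 ^ 2))

/-- THE ALGEBRAIC HEART (pointwise, no derivatives): on the open square the Legendre integrand IS the
pulled-back area density, `F_m(x) = (1 − |Φ_m x|²)^{-1/2} · det DΦ_m(x)`, because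
`1 − X² − Z² = (1 − x²)(1 − y²)` and `κe′ + eκ′ − κκ′ = (1 − m x² − (1−m)y²)/(√(1−x²)√(1−y²)·√(1−mx²)√(1−(1−m)y²))`.
(Hand-verified polynomial identity; numerically 1e−14 at m ∈ {0.05, 0.3, 0.5, 0.9}.) -/
def JacobianIdentity : Prop :=
  ∀ (m : ℝ), m ∈ Ioo (0:ℝ) 1 → ∀ x ∈ sq,
    legendreOneRep m x = hemisphereDensity (spheroConal m x) * |spheroConalDet m x|

/-- `Φ_m` is a bijection of the open square onto the open quarter disc (explicit inverse: `y²` = the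
smaller root of `(1−m)b² − (1 − mX² + (1−m)Z²)b + Z² = 0`, `x² = X²/(1 − (1−m)y²)`), differentiable
with the stated Jacobian. -/
def SpheroConalBijOn : Prop :=
  ∀ (m : ℝ), m ∈ Ioo (0:ℝ) 1 →
    BijOn (spheroConal m) sq quarterDisc ∧
    ∀ x ∈ sq, HasFDerivAt (spheroConal m)
      (LinearMap.toContinuousLinearMap
        (Matrix.toLin' !![Real.sqrt (1 - (1 - m) * x 1 ^ 2), -((1 - m) * x 0 * x 1) / Real.sqrt (1 - (1 - m) * x 1 ^ 2);
                          -(m * x 0 * x 1) / Real.sqrt (1 - m * x 0 ^ 2), Real.sqrt (1 - m * x 0 ^ 2)])) x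

/-- **FIRST LEMMA (`OctantTransfer`)**: for every real-algebraic `m ∈ (0,1)`, ONE rule-(2) move takes the
one-representation Legendre representation `[sq, F_m]` to the octant-area representation
`[quarter disc, (1 − X² − Z²)^{-1/2}]` — the move is `Φ_m = spheroConal m` (ℚ-semialgebraic since `m` is
algebraic; at `m = ½` its graph is cut out over ℚ). This is the C⁺-transfer of the card: it is the whole of
route GaussManinCertificates' `LegendreSector` minus the octant-area tail. -/
def OctantTransfer : Prop :=
  ∀ (m : ℝ), IsAlgebraic ℚ m → m ∈ Ioo (0:ℝ) 1 →
    ∀ (q p : IntegralRep 2), q.domain = sq → EqOn q.integrand (legendreOneRep m) q.domain →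
      p.domain = quarterDisc → EqOn p.integrand hemisphereDensity p.domain →
      KZ.of q - KZ.of p ∈ changeOfVariablesRel

/-- **OCTANT AREA TAIL (`OctantArea`)**: `[quarter disc, (1−X²−Z²)^{-1/2}] ~ [ℝ, 1/(2(1+s²))]` — rational
polar coordinates `P(s,r) = (r(1−s²)/(1+s²), 2rs/(1+s²))` (rule 2, Jacobian `2r/(1+s²)`), ONE
Newton–Leibniz move in `r` with the algebraic primitive `−2√(1−r²)/(1+s²)` (continuous on `[0,1]`),
then the arctangent bookkeeping `(0,1) → ℝ`; ALTERNATIVELY Archimedes' hat-box: `(x,y) ↦ (Z, s)`,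
`s = Y/(X + √(X²+Y²))`, maps `sq → sq` with `F_m = (2/(1+s²))·|det|`, then NL in `Z` (primitive `2Z/(1+s²)`). -/
def OctantArea : Prop :=
  ∀ (p : IntegralRep 2) (r' : IntegralRep 1), p.domain = quarterDisc →
    EqOn p.integrand hemisphereDensity p.domain → r'.domain = univ →
    EqOn r'.integrand (fun x => 1 / (2 * (1 + x 0 ^ 2))) r'.domain → Equivalent p r'

/-- **SYMMETRISATION (`CruxSymmetrise`)**, shared with the sibling cards' move M1: at `m = ½`,
`[sq, 2e⊗κ − κ⊗κ] ≡ [sq, e⊗κ] + [sq, (e−κ)⊗κ] ≡ [sq, κ⊗e] + [sq, (e−κ)⊗κ] ≡ [sq, F_{1/2}]`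
(two integrand-additivity moves around one swap change of variables; no division by 2). -/
def CruxSymmetrise : Prop :=
  ∀ (r q : IntegralRep 2), r.domain = sq → EqOn r.integrand cruxIntegrand r.domain →
    q.domain = sq → EqOn q.integrand (legendreOneRep (1 / 2)) q.domain → Equivalent r q

/-- The intended composition for crux-plan (shape only, recorded as a Prop): symmetrise, transfer to the
octant at `m = ½` (algebraic!), integrate the octant. -/
def octant_line_shape : Prop :=
  CruxSymmetrise → OctantTransfer → OctantArea →
    Summit.KontsevichZagierPeriods.KontsevichZagierPeriods.Theses.Grothendieck.GpcLegendreLemniscatic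

/-- VERBATIM restatement of `Summit.KontsevichZagierPeriods.KontsevichZagierPeriods.Theses.GaussManinCertificates.LegendreSector`
(item stmt-KontsevichZagierPeriods-3013; copied so that this sketch does not import that route module — the two
Props are syntactically identical, cf. the definitional `example` below). -/
def LegendreSectorVerbatim : Prop :=
  ∀ (F : ℝ → (Fin 2 → ℝ) → ℝ), (∀ (m : ℝ) (x : Fin 2 → ℝ), F m x = 1 / Real.sqrt ((1 - x 0 ^ 2) * (1 - m * x 0 ^ 2)) * (Real.sqrt (1 - (1 - m) * x 1 ^ 2) / Real.sqrt (1 - x 1 ^ 2)) + Real.sqrt (1 - m * x 0 ^ 2) / Real.sqrt (1 - x 0 ^ 2) * (1 / Real.sqrt ((1 - x 1 ^ 2) * (1 - (1 - m) * x 1 ^ 2))) - 1 / Real.sqrt ((1 - x 0 ^ 2) * (1 - m * x 0 ^ 2)) * (1 / Real.sqrt ((1 - x 1 ^ 2) * (1 - (1 - m) * x 1 ^ 2)))) → ∀ (m : ℝ), IsAlgebraic ℚ m → m ∈ Set.Ioo (0 : ℝ) 1 → ∀ (r : Literature.NumberTheory.Transcendental.KZ.IntegralRep 2) (r' : Literature.NumberTheory.Transcendental.KZ.IntegralRep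 1), r.domain = {x | ∀ i, x i ∈ Set.Ioo (0 : ℝ) 1} → Set.EqOn r.integrand (F m) r.domain → r'.domain = Set.univ → Set.EqOn r'.integrand (fun x => 1 / (2 * (1 + x 0 ^ 2))) r'.domain → Literature.NumberTheory.Transcendental.KZ.Equivalent r r'

/-- The C⁺ transfer, shape: the same two lemmas give route GaussManinCertificates' `LegendreSector`
(Legendre's relation at every real-algebraic modulus) with NO anchor, NO certificate, NO parameter band. -/
def sector_line_shape : Prop :=
  OctantTransfer → OctantArea → LegendreSectorVerbatim

/-- Sanity (definitional): the integrand family of `LegendreSector` (hypothesis `hF` copied verbatim) is `legendreOneRep`. -/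
example (F : ℝ → (Fin 2 → ℝ) → ℝ)
    (hF : ∀ (m : ℝ) (x : Fin 2 → ℝ), F m x = 1 / Real.sqrt ((1 - x 0 ^ 2) * (1 - m * x 0 ^ 2)) * (Real.sqrt (1 - (1 - m) * x 1 ^ 2) / Real.sqrt (1 - x 1 ^ 2)) + Real.sqrt (1 - m * x 0 ^ 2) / Real.sqrt (1 - x 0 ^ 2) * (1 / Real.sqrt ((1 - x 1 ^ 2) * (1 - (1 - m) * x 1 ^ 2))) - 1 / Real.sqrt ((1 - x 0 ^ 2) * (1 - m * x 0 ^ 2)) * (1 / Real.sqrt ((1 - x 1 ^ 2) * (1 - (1 - m) * x 1 ^ 2))))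
    (m : ℝ) (x : Fin 2 → ℝ) : F m x = legendreOneRep m x := by
  rw [hF]; rfl

/-- Sanity (the sphere): `X² + Y² + Z² = 1` for `Ψ = (x√(1−(1−m)y²), √((1−x²)(1−y²)), y√(1−mx²))` on the square. -/
example (m : ℝ) (x : Fin 2 → ℝ) (hx : x ∈ sq) (hm : m ∈ Ioo (0:ℝ) 1) :
    (x 0 * Real.sqrt (1 - (1 - m) * x 1 ^ 2)) ^ 2 + (Real.sqrt ((1 - x 0 ^ 2) * (1 - x 1 ^ 2))) ^ 2 +
      (x 1 * Real.sqrt (1 - m * x 0 ^ 2)) ^ 2 = 1 := by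
  have h0 := hx 0; have h1 := hx 1
  have hx0 : x 0 ^ 2 < 1 := by nlinarith [h0.1, h0.2]
  have hx1 : x 1 ^ 2 < 1 := by nlinarith [h1.1, h1.2]
  have ha : 0 ≤ 1 - (1 - m) * x 1 ^ 2 := by nlinarith [hm.1, hm.2, sq_nonneg (x 1)]
  have hb : 0 ≤ (1 - x 0 ^ 2) * (1 - x 1 ^ 2) := by nlinarith
  have hc : 0 ≤ 1 - m * x 0 ^ 2 := by nlinarith [hm.1, hm.2, sq_nonneg (x 0)]
  rw [mul_pow, mul_pow, Real.sq_sqrt ha, Real.sq_sqrt hb, Real.sq_sqrt hc]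
  ring

/-- The RATIONAL density of the unit sphere in the stereographic chart from the south pole,
`dA = 4 dp dq/(1 + p² + q²)²`. -/
def stereoDensity (w : Fin 2 → ℝ) : ℝ := 4 / (1 + w 0 ^ 2 + w 1 ^ 2) ^ 2

/-- **Sphero-conal map, stereographic chart**: `Σ_m(x,y) = (X/(1+Z), Y/(1+Z))` with
`(X,Y,Z) = Ψ_m(x,y)`; maps the open square onto the open quarter disc (the stereographic image of the
open octant), and `Σ_m^*(4 dp dq/(1+p²+q²)²) = F_m dx dy` (checked numerically to 1e−9). After this ONE
move every representation of the line is RATIONAL (KZ's literal shape). -/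
def spheroConalStereo (m : ℝ) (x : Fin 2 → ℝ) : Fin 2 → ℝ :=
  ![x 0 * Real.sqrt (1 - (1 - m) * x 1 ^ 2) / (1 + x 1 * Real.sqrt (1 - m * x 0 ^ 2)),
    Real.sqrt ((1 - x 0 ^ 2) * (1 - x 1 ^ 2)) / (1 + x 1 * Real.sqrt (1 - m * x 0 ^ 2))]

/-- Variant first lemma (`OctantTransferStereo`): ONE rule-(2) move `[sq, F_m] ~ [Q, 4/(1+p²+q²)²]`. -/
def OctantTransferStereo : Prop :=
  ∀ (m : ℝ), IsAlgebraic ℚ m → m ∈ Ioo (0:ℝ) 1 →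
    ∀ (q p : IntegralRep 2), q.domain = sq → EqOn q.integrand (legendreOneRep m) q.domain →
      p.domain = quarterDisc → EqOn p.integrand stereoDensity p.domain →
      KZ.of q - KZ.of p ∈ changeOfVariablesRel

/-- Rational octant tail (`RationalOctantArea`): `[Q, 4/(1+p²+q²)²] ~ [ℝ, 1/(2(1+s²))]` — rational polar
coordinates `P(s,r)` (Jacobian `2r/(1+s²)`), ONE Newton–Leibniz move in `r` with the RATIONAL primitive
`−4/((1+r²)(1+s²))` (`∫₀¹ 4r dr/(1+r²)² = 1`), arctangent bookkeeping. Every datum rational over ℚ. -/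
def RationalOctantArea : Prop :=
  ∀ (p : IntegralRep 2) (r' : IntegralRep 1), p.domain = quarterDisc →
    EqOn p.integrand stereoDensity p.domain → r'.domain = univ →
    EqOn r'.integrand (fun x => 1 / (2 * (1 + x 0 ^ 2))) r'.domain → Equivalent p r'

/-- Shape of the all-rational line for crux-plan. -/
def rational_octant_line_shape : Prop :=
  CruxSymmetrise → OctantTransferStereo → RationalOctantArea →
    Summit.KontsevichZagierPeriods.KontsevichZagierPeriods.Theses.Grothendieck.GpcLegendreLemniscatic

/-- Component `0` of the sphero-conal map. -/
theorem spheroConal_apply_zero (m : ℝ) (x : Fin 2 → ℝ) :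
    spheroConal m x 0 = x 0 * Real.sqrt (1 - (1 - m) * x 1 ^ 2) := by
  simp [spheroConal]

/-- Component `1` of the sphero-conal map. -/
theorem spheroConal_apply_one (m : ℝ) (x : Fin 2 → ℝ) :
    spheroConal m x 1 = x 1 * Real.sqrt (1 - m * x 0 ^ 2) := by
  simp [spheroConal]

/-- **`Φ_m` maps the open square into the open quarter disc** (`1 − X² − Z² = (1−x²)(1−y²) > 0`). -/
theorem spheroConal_mapsTo (m : ℝ) (hm : m ∈ Ioo (0:ℝ) 1) : MapsTo (spheroConal m) sq quarterDisc := by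
  intro x hx
  have h0 := hx 0
  have h1 := hx 1
  have hA : 0 < 1 - x 0 ^ 2 := by nlinarith [h0.1, h0.2]
  have hB : 0 < 1 - x 1 ^ 2 := by nlinarith [h1.1, h1.2]
  have hC : 0 < 1 - m * x 0 ^ 2 := by nlinarith [hm.1, hm.2, sq_nonneg (x 0)]
  have hD : 0 < 1 - (1 - m) * x 1 ^ 2 := by nlinarith [hm.1, hm.2, sq_nonneg (x 1)]
  refine ⟨?_, ?_, ?_⟩
  · rw [spheroConal_apply_zero]; exact mul_pos h0.1 (Real.sqrt_pos.2 hD)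
  · rw [spheroConal_apply_one]; exact mul_pos h1.1 (Real.sqrt_pos.2 hC)
  · rw [spheroConal_apply_zero, spheroConal_apply_one, mul_pow, mul_pow, Real.sq_sqrt hD.le,
      Real.sq_sqrt hC.le]
    nlinarith [mul_pos hA hB]

/-- **`Φ_m` is injective on the open square** — the card's SIGN ARGUMENT, kernel-checked: with `a = x²`, `b = y²`,
both `b` and `b′` are roots of the same quadratic `q(t) = (1−m)t² − (1 − mX² + (1−m)Z²)t + Z²`, both are `< 1`, and
`q(1) = −m(1 − X² − Z²) < 0` forbids two roots below `1`; then `a = a′` from `X² = a(1 − (1−m)b)`. -/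
theorem spheroConal_injOn (m : ℝ) (hm : m ∈ Ioo (0:ℝ) 1) : InjOn (spheroConal m) sq := by
  intro x hx x' hx' heq
  have h0 := hx 0
  have h1 := hx 1
  have h0' := hx' 0
  have h1' := hx' 1
  have ha1 : x 0 ^ 2 < 1 := by nlinarith [h0.1, h0.2]
  have hb1 : x 1 ^ 2 < 1 := by nlinarith [h1.1, h1.2]
  have ha1' : x' 0 ^ 2 < 1 := by nlinarith [h0'.1, h0'.2]
  have hb1' : x' 1 ^ 2 < 1 := by nlinarith [h1'.1, h1'.2]
  have hC : 0 < 1 - m * x 0 ^ 2 := by nlinarith [mul_lt_mul_of_pos_left ha1 hm.1, hm.2]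
  have hD : 0 < 1 - (1 - m) * x 1 ^ 2 := by nlinarith [mul_lt_mul_of_pos_left hb1 (sub_pos.2 hm.2), hm.1]
  have hC' : 0 < 1 - m * x' 0 ^ 2 := by nlinarith [mul_lt_mul_of_pos_left ha1' hm.1, hm.2]
  have hD' : 0 < 1 - (1 - m) * x' 1 ^ 2 := by nlinarith [mul_lt_mul_of_pos_left hb1' (sub_pos.2 hm.2), hm.1]
  have hX : x 0 * Real.sqrt (1 - (1 - m) * x 1 ^ 2) = x' 0 * Real.sqrt (1 - (1 - m) * x' 1 ^ 2) := by
    have := congrFun heq 0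
    rwa [spheroConal_apply_zero, spheroConal_apply_zero] at this
  have hZ : x 1 * Real.sqrt (1 - m * x 0 ^ 2) = x' 1 * Real.sqrt (1 - m * x' 0 ^ 2) := by
    have := congrFun heq 1
    rwa [spheroConal_apply_one, spheroConal_apply_one] at this
  have hX2 : x 0 ^ 2 * (1 - (1 - m) * x 1 ^ 2) = x' 0 ^ 2 * (1 - (1 - m) * x' 1 ^ 2) := by
    have := congrArg (fun t => t ^ 2) hX
    simpa only [mul_pow, Real.sq_sqrt hD.le, Real.sq_sqrt hD'.le] using this
  have hZ2 : x 1 ^ 2 * (1 - m * x 0 ^ 2) = x' 1 ^ 2 * (1 - m * x' 0 ^ 2) := by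
    have := congrArg (fun t => t ^ 2) hZ
    simpa only [mul_pow, Real.sq_sqrt hC.le, Real.sq_sqrt hC'.le] using this
  -- pass to the squares
  set a := x 0 ^ 2 with ha
  set b := x 1 ^ 2 with hb
  set a' := x' 0 ^ 2 with ha'
  set b' := x' 1 ^ 2 with hb'
  -- the quadratic: q(b) = 0 (identity) and q(b') = 0 (through hX2, hZ2)
  have hqb : (1 - m) * b ^ 2 - (1 - m * (a * (1 - (1 - m) * b)) + (1 - m) * (b * (1 - m * a))) * b +
      b * (1 - m * a) = 0 := by ring
  have hqb' : (1 - m) * b' ^ 2 - (1 - m * (a * (1 - (1 - m) * b)) + (1 - m) * (b * (1 - m * a))) * b' +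
      b * (1 - m * a) = 0 := by
    rw [hX2, hZ2]; ring
  have hbb : b = b' := by
    by_contra hne
    have hdiff : (b - b') * ((1 - m) * (b + b') -
        (1 - m * (a * (1 - (1 - m) * b)) + (1 - m) * (b * (1 - m * a)))) = 0 := by
      linear_combination hqb - hqb'
    rcases mul_eq_zero.1 hdiff with h | h
    · exact hne (sub_eq_zero.1 h)
    · have e2 : b * (1 - m * a) - (1 - m) * b * b' = 0 := by linear_combination hqb - b * h
      have key : (1 - m) * (1 - b) * (1 - b') + m * ((1 - a) * (1 - b)) = 0 := by
        linear_combination (-1 : ℝ) * h - e2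
      have p1 : 0 < (1 - m) * (1 - b) * (1 - b') :=
        mul_pos (mul_pos (sub_pos.2 hm.2) (sub_pos.2 hb1)) (sub_pos.2 hb1')
      have p2 : 0 < m * ((1 - a) * (1 - b)) := mul_pos hm.1 (mul_pos (sub_pos.2 ha1) (sub_pos.2 hb1))
      linarith
  have haa : a = a' := by
    rw [← hbb] at hX2
    exact mul_right_cancel₀ hD.ne' hX2
  -- conclude
  refine funext_iff.2 (Fin.forall_fin_two.2 ⟨?_, ?_⟩)
  · exact (pow_left_inj₀ h0.1.le h0'.1.le two_ne_zero).1 haa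
  · exact (pow_left_inj₀ h1.1.le h1'.1.le two_ne_zero).1 hbb

set_option maxHeartbeats 1600000 in
/-- **`Φ_m` maps the open square ONTO the open quarter disc** — the explicit algebraic inverse of the card,
kernel-checked: `b = y²` is the smaller root `(B − √D)/(2(1−m))` of `q`, `a = x² = X²/(1 − (1−m)b)`; `0 < b < 1` and
`0 < a < 1` follow from `q(1) < 0`, `q(b*) < 0` through `4(1−m)q(t) = (2(1−m)t − B)² − D`. -/
theorem spheroConal_surjOn (m : ℝ) (hm : m ∈ Ioo (0:ℝ) 1) : SurjOn (spheroConal m) sq quarterDisc := by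
  intro w hw
  obtain ⟨hX, hZ, hXZ⟩ := hw
  set X := w 0 with hXdef
  set Z := w 1 with hZdef
  have hm0 := hm.1
  have hm1 := hm.2
  have h1m : 0 < 1 - m := sub_pos.2 hm1
  have hgap : 0 < 1 - X ^ 2 - Z ^ 2 := by linarith
  have hX21 : X ^ 2 < 1 := by nlinarith [sq_nonneg Z]
  set B := 1 - m * X ^ 2 + (1 - m) * Z ^ 2 with hB
  set D := B ^ 2 - 4 * (1 - m) * Z ^ 2 with hDdef
  -- the completed square: 4(1-m) q(t) = (2(1-m)t - B)² - D
  have hcsq : ∀ t : ℝ, 4 * (1 - m) * ((1 - m) * t ^ 2 - B * t + Z ^ 2) = (2 * (1 - m) * t - B) ^ 2 - D := by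
    intro t; rw [hDdef]; ring
  have hq1 : (1 - m) * 1 ^ 2 - B * 1 + Z ^ 2 = -(m * (1 - X ^ 2 - Z ^ 2)) := by rw [hB]; ring
  have hDpos : 0 < D := by
    have h := hcsq 1
    rw [hq1] at h
    nlinarith [sq_nonneg (2 * (1 - m) * 1 - B), mul_pos h1m (mul_pos hm0 hgap)]
  set s := Real.sqrt D with hsdef
  have hs0 : 0 < s := Real.sqrt_pos.2 hDpos
  have hs2 : s ^ 2 = D := Real.sq_sqrt hDpos.le
  set b := (B - s) / (2 * (1 - m)) with hbdef
  have h2b : 2 * (1 - m) * b = B - s := by rw [hbdef]; field_simp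
  -- q(b) = 0
  have hqb : (1 - m) * b ^ 2 - B * b + Z ^ 2 = 0 := by
    have h := hcsq b
    have h' : (2 * (1 - m) * b - B) ^ 2 - D = 0 := by rw [h2b, ← hs2]; ring
    rw [h'] at h
    have h4 : (4 * (1 - m)) ≠ 0 := by positivity
    exact (mul_eq_zero.1 h).resolve_left h4
  -- 0 < b : s < B
  have hBpos : 0 < B := by
    rw [hB]; nlinarith [mul_lt_mul_of_pos_left hX21 hm0, mul_nonneg h1m.le (sq_nonneg Z)]
  have hsB : s < B := by
    rw [hsdef, Real.sqrt_lt' hBpos, hDdef]; nlinarith [mul_pos h1m (pow_pos hZ 2)]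
  have hb0 : 0 < b := by rw [hbdef]; exact div_pos (by linarith) (by positivity)
  -- b < 1 : |2(1-m) - B| < s
  have hb1 : b < 1 := by
    have hsq : (2 * (1 - m) * 1 - B) ^ 2 < s ^ 2 := by
      have h := hcsq 1
      rw [hq1] at h
      rw [hs2]; nlinarith [mul_pos h1m (mul_pos hm0 hgap)]
    have hlow := (abs_lt_of_sq_lt_sq' hsq hs0.le).1
    have hlt : 2 * (1 - m) * b < 2 * (1 - m) * 1 := by linarith
    exact lt_of_mul_lt_mul_left hlt (by positivity)
  -- a
  have hc : 0 < 1 - (1 - m) * b := by nlinarith [mul_lt_mul_of_pos_left hb1 h1m]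
  set a := X ^ 2 / (1 - (1 - m) * b) with hadef
  have haX : a * (1 - (1 - m) * b) = X ^ 2 := by rw [hadef]; field_simp
  have ha0 : 0 < a := div_pos (pow_pos hX 2) hc
  have ha1 : a < 1 := by
    set bs := (1 - X ^ 2) / (1 - m) with hbs
    have hbs' : (1 - m) * bs = 1 - X ^ 2 := by rw [hbs]; field_simp
    have hqbs : (1 - m) * bs ^ 2 - B * bs + Z ^ 2 = -(X ^ 2 * (1 - X ^ 2 - Z ^ 2)) := by
      have e : (1 - m) * bs ^ 2 - B * bs + Z ^ 2 = bs * ((1 - m) * bs) - B * bs + Z ^ 2 := by ring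
      rw [e, hbs', hB]
      have e2 : bs * (1 - X ^ 2) - (1 - m * X ^ 2 + (1 - m) * Z ^ 2) * bs + Z ^ 2 =
          -((1 - m) * bs) * (X ^ 2 + Z ^ 2) + Z ^ 2 := by ring
      rw [e2, hbs']; ring
    have hsq : (2 * (1 - m) * bs - B) ^ 2 < s ^ 2 := by
      have h := hcsq bs
      rw [hqbs] at h
      rw [hs2]; nlinarith [mul_pos h1m (mul_pos (pow_pos hX 2) hgap)]
    have hlow := (abs_lt_of_sq_lt_sq' hsq hs0.le).1
    have hlt : 2 * (1 - m) * b < 2 * (1 - m) * bs := by linarith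
    have hbbs : b < bs := lt_of_mul_lt_mul_left hlt (by positivity)
    rw [hadef, div_lt_one hc]
    linarith [mul_lt_mul_of_pos_left hbbs h1m, hbs']
  -- Z-equation for the preimage
  have hbZ : b * (1 - m * a) = Z ^ 2 := by
    apply mul_left_cancel₀ hc.ne'
    have e : (1 - (1 - m) * b) * (b * (1 - m * a)) = b * (1 - (1 - m) * b) - m * b * (a * (1 - (1 - m) * b)) := by
      ring
    rw [e, haX]
    have hqb' := hqb
    rw [hB] at hqb'
    linear_combination (-1 : ℝ) * hqb'
  -- the preimage
  refine ⟨![Real.sqrt a, Real.sqrt b], ?_, ?_⟩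
  · intro i
    fin_cases i
    · show Real.sqrt a ∈ Ioo (0:ℝ) 1
      exact ⟨Real.sqrt_pos.2 ha0, (Real.sqrt_lt' one_pos).2 (by simpa using ha1)⟩
    · show Real.sqrt b ∈ Ioo (0:ℝ) 1
      exact ⟨Real.sqrt_pos.2 hb0, (Real.sqrt_lt' one_pos).2 (by simpa using hb1)⟩
  · refine funext_iff.2 (Fin.forall_fin_two.2 ⟨?_, ?_⟩)
    · rw [spheroConal_apply_zero]
      simp only [Matrix.cons_val_zero, Matrix.cons_val_one]
      rw [Real.sq_sqrt hb0.le, ← Real.sqrt_mul ha0.le, haX, Real.sqrt_sq hX.le]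
    · rw [spheroConal_apply_one]
      simp only [Matrix.cons_val_zero, Matrix.cons_val_one]
      rw [Real.sq_sqrt ha0.le, ← Real.sqrt_mul hb0.le, hbZ, Real.sqrt_sq hZ.le]

/-- **`Φ_m : (0,1)² → Q` is a bijection** (MapsTo + InjOn + SurjOn, all kernel-checked above). -/
theorem spheroConal_bijOn (m : ℝ) (hm : m ∈ Ioo (0:ℝ) 1) : BijOn (spheroConal m) sq quarterDisc :=
  ⟨spheroConal_mapsTo m hm, spheroConal_injOn m hm, spheroConal_surjOn m hm⟩

/-- **The algebraic heart is kernel-checked**: `JacobianIdentity` holds (pure algebra of four square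
roots `a = √(1−x²)`, `b = √(1−y²)`, `c = √(1−mx²)`, `d = √(1−(1−m)y²)`: both sides equal
`(c² + d² − 1)/(abcd)`). -/
theorem jacobianIdentity_holds : JacobianIdentity := by
  intro m hm x hx
  have h0 := hx 0
  have h1 := hx 1
  have hx0 : x 0 ^ 2 < 1 := by nlinarith [h0.1, h0.2]
  have hx1 : x 1 ^ 2 < 1 := by nlinarith [h1.1, h1.2]
  have hA : 0 < 1 - x 0 ^ 2 := by linarith
  have hB : 0 < 1 - x 1 ^ 2 := by linarith
  have hC : 0 < 1 - m * x 0 ^ 2 := by nlinarith [hm.1, hm.2, sq_nonneg (x 0)]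
  have hD : 0 < 1 - (1 - m) * x 1 ^ 2 := by nlinarith [hm.1, hm.2, sq_nonneg (x 1)]
  unfold legendreOneRep hemisphereDensity spheroConal spheroConalDet
  simp only [Matrix.cons_val_zero, Matrix.cons_val_one]
  rw [Real.sqrt_mul hA.le, Real.sqrt_mul hB.le]
  set a := Real.sqrt (1 - x 0 ^ 2) with ha
  set b := Real.sqrt (1 - x 1 ^ 2) with hb
  set c := Real.sqrt (1 - m * x 0 ^ 2) with hc
  set d := Real.sqrt (1 - (1 - m) * x 1 ^ 2) with hd
  have ha0 : 0 < a := Real.sqrt_pos.2 hA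
  have hb0 : 0 < b := Real.sqrt_pos.2 hB
  have hc0 : 0 < c := Real.sqrt_pos.2 hC
  have hd0 : 0 < d := Real.sqrt_pos.2 hD
  have hc2 : c ^ 2 = 1 - m * x 0 ^ 2 := Real.sq_sqrt hC.le
  have hd2 : d ^ 2 = 1 - (1 - m) * x 1 ^ 2 := Real.sq_sqrt hD.le
  have hrad : 1 - (x 0 * d) ^ 2 - (x 1 * c) ^ 2 = (1 - x 0 ^ 2) * (1 - x 1 ^ 2) := by
    rw [mul_pow, mul_pow, hd2, hc2]; ring
  rw [hrad, Real.sqrt_mul hA.le, ← ha, ← hb]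
  have hnum : 0 < 1 - m * x 0 ^ 2 - (1 - m) * x 1 ^ 2 := by nlinarith [hm.1, hm.2, mul_pos hm.1 hA]
  rw [abs_of_pos (div_pos hnum (mul_pos hc0 hd0))]
  have ha1 : a ≠ 0 := ha0.ne'
  have hb1 : b ≠ 0 := hb0.ne'
  have hc1 : c ≠ 0 := hc0.ne'
  have hd1 : d ≠ 0 := hd0.ne'
  -- polynomial identity modulo c² and d²
  have key : d ^ 2 + c ^ 2 - 1 = 1 - m * x 0 ^ 2 - (1 - m) * x 1 ^ 2 := by rw [hd2, hc2]; ring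
  rw [show 1 / (a * c) * (d / b) + c / a * (1 / (b * d)) - 1 / (a * c) * (1 / (b * d)) =
      (d ^ 2 + c ^ 2 - 1) / (a * b * c * d) by field_simp]
  rw [show 1 / (a * b) * ((1 - m * x 0 ^ 2 - (1 - m) * x 1 ^ 2) / (c * d)) =
      (1 - m * x 0 ^ 2 - (1 - m) * x 1 ^ 2) / (a * b * c * d) by rw [div_mul_div_comm, one_mul]; ring]
  rw [key]

end Summit.KontsevichZagierPeriods.KontsevichZagierPeriods.Cruxes.GpcLegendreLemniscatic.SpheroConal
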